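import Mathlib

/-!
# Stub `stub_blockSum` (S5) for crux stmt-ValiantsHypothesis-6625, line `Sketch`

The shifted transversal blocks `B_k = {(r, c) | r = c + k}` partition the variables, and a letter carries
at most one variable, so the per-block letter counts of a word sum to at most its length:
`∑ k, countP (letter carries a B_k-variable) w ≤ length w`.
-/

-- `Summit.ValiantsHypothesis.ValiantsHypothesis.…` is the tree's mandated single-conjunct layout.
set_option linter.dupNamespace false

namespace Summit.ValiantsHypothesis.ValiantsHypothesis.Theorems.ElementaryWordLengthWordPerCubic

/-- One letter lies in at most one block: the indicator sum over the shifts `k` of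
"the optional variable `o` satisfies `r = c + k`" is at most `1`. [folklore] -/
theorem sum_ite_any_block_le_one (n : ℕ) (o : Option (Fin n × Fin n)) :
    ∑ k : Fin n, (if (o.any fun v => decide (v.1 = v.2 + k)) = true then 1 else 0) ≤ 1 := by
  cases o with
  | none => simp
  | some v =>
    simp only [Option.any_some, decide_eq_true_eq]
    rw [Finset.sum_boole, Nat.cast_id]
    refine Finset.card_le_one.2 fun a ha b hb => ?_
    rw [Finset.mem_filter] at ha hb
    exact add_left_cancel (ha.2.symm.trans hb.2)

/-- S5 — **blocks partition the letters**: a letter carries a variable of at most one block `B_k`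
(`(r, c) ∈ B_k ↔ r = c + k`), so the block letter counts sum to at most the length. -/
theorem stub_blockSum (n : ℕ) (w : List (Fin 3 × Fin 3 × ℂ × Option (Fin n × Fin n))) :
    ∑ k : Fin n, w.countP (fun l => l.2.2.2.any (fun v => decide (v.1 = v.2 + k))) ≤ w.length := by
  induction w with
  | nil => simp
  | cons l w ih =>
    simp only [List.countP_cons, Finset.sum_add_distrib, List.length_cons]
    exact Nat.add_le_add ih (sum_ite_any_block_le_one n l.2.2.2)

end Summit.ValiantsHypothesis.ValiantsHypothesis.Theorems.ElementaryWordLengthWordPerCubic
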